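import Literature.NumberTheory.Automorphic.ReciprocityGLnProofs
import Literature.NumberTheory.GaloisRepresentations.OrdinaryRegular
import Literature.NumberTheory.GaloisRepresentations.PstWeilDeligne
import Literature.NumberTheory.GaloisRepresentations.ResidualGaloisRep
import Literature.NumberTheory.GaloisRepresentations.EnormousSubgroup
import Literature.NumberTheory.GaloisRepresentations.DecomposedGeneric
import HarnessLib

/-!
# Qian 2023, Thm. 1.4 (and Thm. 1.1): potential automorphy of a single ordinary `ℓ`-adic (resp. of a residual) representation of `Γ_K`, `K` CM

Topic `NumberTheory/Automorphic` (vocabulary of `ReciprocityGLn` / `ReciprocityGLnProofs`: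
`CuspidalAutomorphicRepData`, `IsRegularAlgebraic`, `IsUnramifiedAbove`,
`IsGaloisCompatibleAt`, `arithFrobPolyOfSatake`; of the Galois-representation files:
`FramedGaloisRep`, `IsUnramifiedAt`, `restrictField`, `IsOrdinaryRegularAt` (`OrdinaryRegular`),
`PstWeilDeligneData.IsDeRhamFramed` (`PstWeilDeligne`), `IsResidualRepOf`, `IsAbsIrreducible`,
`padicAlgClResidueField` (`ResidualGaloisRep`), `Subgroup.IsEnormous` (`EnormousSubgroup`),
`IsDecomposedGeneric`, `absGaloisGroupAdjoinRootsOfUnity` (`DecomposedGeneric`)).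

L. Qian, *Potential automorphy for `GL_n`*, Invent. Math. 231 (2023) 1239–1275
(= arXiv:2104.09761), **Theorem 1.4** (p. 2), as printed:

> Suppose `F` is a CM number field, `F^{av}` is a finite extension of `F` and `n ≥ 2` is a
> positive integer. Let `l` be a prime number. Fix an isomorphism `ι : ℚ̄_l → ℂ` and suppose that
> `r : G_F → GL_n(ℚ̄_l)` is a continuous representation satisfying the following condition:
> • `r` is unramified almost everywhere.
> • For each place `v | l` of `F`, the representation `r|_{G_{F_v}}` is potentially semistable,
>   ordinary with regular Hodge–Tate weights `λ ∈ (ℤⁿ₊)^{Hom(F, ℚ̄_p)}`.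
> • `r̄` is absolutely irreducible and decomposed generic (See [ACC+18] Definition 4.3.1). The
>   image of `r̄|_{G_{F(ζ_l)}}` is enormous (See [ACC+18] Definition 6.2.28).
> • There exists `σ ∈ G_F − G_{F(ζ_l)}` such that `r̄(σ)` is a scalar.
> Then there exists a finite CM Galois extension `F′/F` linearly disjoint from `F^{av}` over `F`
> such that `r|_{G_{F′}}` is ordinarily automorphic.

with (p. 1–2) "we could attach to any regular algebraic cuspidal automorphic representation `π`
of `GL_n(𝔸_E)` an `l`-adic Galois representation … by the main theorem of [HLTT16]. More
precisely, fix an isomorphism `ℚ̄_l → ℂ`. For such a `π`, there is a unique continuous semisimple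
representation `r_{l,ι}(π) : G_E → GL_n(ℚ̄_l)` such that, if `p ≠ l` is a rational prime above
which `π` and `E` are unramified and if `v | p` is a prime of `E`, then `r_{l,ι}(π)` is
unramified at `v` [and] `r_{l,ι}(π)|^{ss}_{W_{E_v}} = ι⁻¹ rec_{E_v}(π_v |det|_v^{(1-n)/2})`",
**Definition 1.3**: "For a Galois representation `r : G_E → GL_n(ℚ̄_l)`, we say it is
*automorphic* if there exists a regular algebraic cuspidal automorphic representation `π` such
that `r ≅ r_{l,ι}(π)`. And for a residual representation `r̄ : G_E → GL_n(𝔽̄_l)`, we say it is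
automorphic if there exists a lift `r` of `r̄` that is automorphic. We say it is *ordinarily
automorphic* if there exists an automorphic lift `r` which is potentially semistable and
ordinary with regular Hodge–Tate weights as `G_{E_v}` representation for all `v | l`", and
**Definition 1.2** (ordinary with regular Hodge–Tate weights) = the tree's
`FramedGaloisRep.IsOrdinaryRegularAt` (`OrdinaryRegular`).  The theorem combines Qian's Thm. 1.1
(residual potential automorphy via Dwork families) with ACC+ Thm. 6.1.2 (ordinary automorphy
lifting) and [Qia21] (ordinarity of the Dwork motives); none is within reach of the library:
NAMED FACT (D-0014).  Requested by route `SelfDefeatingInduction` (summit `Langlands`, item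
`QianPotentialAutomorphyInput`), which consumes it with `n = 2m`, `r = Ind_{Γ_F}^{Γ_K} ρ`.

## Contents and rendering

* `Qian2022.IsCompatible π ι r` — Qian's characterising property of `r_{l,ι}(π)` (p. 1): for
  every rational prime `p ≠ ℓ` above which **both `π` and `K`** are unramified
  (`IsUnramifiedAbove`; Mathlib `Algebra.IsUnramifiedIn (𝓞 K) (p)`) and every `v ∣ p`, `r` is
  unramified at `v` with the predicted characteristic polynomial of Frobenius
  (`IsGaloisCompatibleAt π ι r v`, the tree's form of
  `r|^{ss}_{W_{K_v}} = ι⁻¹ rec(π_v|det|^{(1-n)/2})` for unramified `π_v`).  This is the wording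
  Qian prints (that of the HLTT preprint); the tree's `HarrisLanTaylorThorne2016.IsCompatible`
  (published Thm. A: no condition on `K` at `p`) implies it (`isCompatible_of_hltt`).
* `Qian2022.IsAutomorphic ι r` — **Def. 1.3** for an `ℓ`-adic `r : Γ_K →ₜ* GL_n(ℚ̄_ℓ)`:
  `r ≅ r_{l,ι}(π)` for some regular algebraic cuspidal `π` of `GL_n(𝔸_K)`, rendered — since
  `r_{l,ι}(π)` is *defined* as the unique continuous semisimple representation with the property
  above — as "`r` is semisimple and has Qian's property for `π`" (invariant under isomorphism;
  the compactness fact `hcpt` needed to type `π` is part of the existential, a true Prop, as in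
  the accepted `potentiallyModular_ellipticCurve_CM`).
* `Qian2022.potentialAutomorphy_ordinary 𝓐 𝓓` — **Thm. 1.4**, relative to local Artin data `𝓐`
  and `p`-adic Hodge data `𝓓` at the finite places of number fields (PARAMETERS, see below).
  Hypotheses: (i) `∀ᶠ v, r.IsUnramifiedAt v`; (ii) at every `v ∣ ℓ`: de Rham relative to
  `𝓓 K ℓ v` (the tree's rendering of "potentially semistable" — de Rham ⇔ potentially
  semistable for the genuine `B_dR`, Berger 2002 / Fontaine — as in the accepted
  `GaloisRep.IsGeometric`, `PstWeilDeligneData`) and `IsOrdinaryRegularAt v (𝓐 K v) r`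
  (Def. 1.2); (iii)–(iv) for SOME residual representation `τ` of `r` over `ℤ̄_ℓ/𝔪 ≅ 𝔽̄_ℓ`
  (`IsResidualRepOf`; `r̄` is only defined up to conjugacy and all four conditions are
  conjugation-invariant, so "some" is the printed hypothesis): `τ` absolutely irreducible,
  decomposed generic, `τ(Γ_{K(ζ_ℓ)})` enormous — ACC+ Def. 6.2.28 predicates "enormous" of "an
  absolutely irreducible subgroup", so the literal hypothesis is: `τ|_{Γ_{K(ζ_ℓ)}}` absolutely
  irreducible AND its image satisfies conditions (1)–(3) (`Subgroup.IsEnormous`, which does not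
  include absolute irreducibility) — and `τ σ` scalar for some `σ ∉ Γ_{K(ζ_ℓ)}`.
  Conclusion: a number field `K′ ⊇ K`, Galois over `K`, CM, with `K^{av} ⊗_K K′` a field
  (linear disjointness over `K`; for `K′/K` Galois this is `K′ ∩ K^{av} = K` in any common
  over-field), such that `r|_{Γ_{K′}}` (`restrictField`) is automorphic in the sense of Def. 1.3.
  Of "ordinarily automorphic" only the automorphy clause is vendored: for the `ℓ`-adic
  `r|_{Γ_{K′}}` the remaining clause of Def. 1.3 ("potentially semistable and ordinary with
  regular Hodge–Tate weights at `v ∣ l`") restates hypothesis (ii) over `K′`; dropping it makes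
  the vendored statement WEAKER than the printed one, never stronger.
* `Qian2022.potentialResidualAutomorphy` — **Thm. 1.1** (p. 1): "Suppose `F` is a CM number
  field, `F^{av}` is a finite extension of `F` and `n ≥ 2` is a positive integer. Let `l` be a
  prime number and suppose that `r̄ : Gal(F̄/F) → GL_n(F̄_l)` is a continuous semisimple
  representation. Then there exists a finite CM Galois extension `F′/F` linearly disjoint from
  `F^{av}` over `F` such that `r̄|_{Gal(F̄/F′)}` is ordinarily automorphic."  Rendered for residual
  representations `τ` of a continuous `r : Γ_K →ₜ* GL_n(ℚ̄_ℓ)` (`IsResidualRepOf`; such `τ` are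
  continuous — `ker` of a reduction is open and `IsSemisimplificationOf` keeps the kernel — and
  semisimple, so this RESTRICTS the printed hypothesis); conclusion: `K′` as in Thm. 1.4 and an
  automorphic (Def. 1.3) `r′ : Γ_{K′} →ₜ* GL_n(ℚ̄_ℓ)` sharing a residual representation `τ′` with
  `r|_{Γ_{K′}}` — an automorphic lift of `r̄|_{Γ_{K′}}`; the ordinarity clause of "ordinarily
  automorphic" is dropped (WEAKER than printed; no local data needed, hence no parameters).
  Grounding by-product of route `Langlands/TameTypeSwitch` (crux `TameTypedWitness`,
  stmt-Langlands-18269), for which it is the nearest print and NOT a match: that crux also demands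
  `ℓ` unramified in `K′` and a weight-`0` witness of depth zero above `ℓ`; Qian's proof (§4: Prop.
  4.2 = Moret-Bailly with `l ∈ S₃`, pp. 23–24) gives no control of `K′` above `l`, cf.
  Guralnick–Harris–Katz 2010 §1 "(b) `ℓ` is unramified in `F′`", "we cannot guarantee".
* Proved glue: `isCompatible_of_hltt`, `IsAutomorphic.of_hltt` (an `r` with HLTT's published
  property for a regular algebraic cuspidal `π` is automorphic in Qian's sense).

## Why the local data are parameters (not universally quantified)

Lean has no construction of the local Artin maps nor of `B_dR`/`D_pst`; the tree types them as
hypothesis structures `LocalArtinData (K_v)` (`LocalClassFieldTheory`) and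
`PstWeilDeligneData (K_v) ℓ` (`PstWeilDeligne`), which are NOT uniquely inhabited (e.g. an Artin
datum composed with the automorphism `u ↦ u⁻¹` of `𝒪_vˣ`, identity on a uniformiser, is again
one).  Ordinarity relative to a non-genuine Artin datum is a different condition (for
`u ↦ u^s`, `s ∈ ℤ_ℓˣ ∖ ℚ`, it holds for non-Hodge–Tate twists of ordinary representations), so a
statement quantifying `∀ art ∀ 𝔇` INSIDE the fact would assert potential automorphy of
representations the printed theorem says nothing about — stronger than the source, possibly
false.  Hence, exactly as the accepted `FontaineMazurLanglandsGLn 𝔅` takes its period-ring data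
as a parameter, the fact is a family of propositions indexed by the data; the printed theorem is
the member at the genuine data (the Artin maps of local class field theory in Deligne's
normalisation, Fontaine's `B_dR(K_v)`), which is how a consumer holding reciprocity data for all
number fields (cf. `Summit.Langlands.ReciprocityData`: `(𝓡 K).llc v).artin`, `(𝓡 K).pst ℓ v`)
instantiates it.  The conclusion involves no local data.

## References

* [Qian2022] L. Qian, *Potential automorphy for `GL_n`*, Invent. Math. 231 (2023), 1239–1275,
  Def. 1.2, Def. 1.3, Thm. 1.1, Thm. 1.4, §4 Prop. 4.2 (held: arXiv:2104.09761, pp. 1–2, 21–24;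
  read 2026-08-15 and 2026-08-17).
* [ACCGHLNSTT2023] P. Allen et al., *Potential automorphy over CM fields*, Ann. of Math. 197
  (2023), Def. 4.3.1, Def. 6.2.28, Thm. 6.1.2 (held: arXiv:1812.09999).
* [HarrisLanTaylorThorneRMS2016] M. Harris, K.-W. Lan, R. Taylor, J. Thorne, *On the rigid
  cohomology of certain Shimura varieties*, Res. Math. Sci. 3:37 (2016), Thm. A (`r_{l,ι}(π)`).
-/

noncomputable section

open scoped MatrixGroups NumberField TensorProduct Classical
open NumberField IsDedekindDomain Field Filter
open Literature.NumberTheory.GaloisRepresentations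

namespace Literature.NumberTheory.Automorphic

namespace Qian2022

section Automorphic

variable {n : ℕ} {K : Type} [Field K] [NumberField K] {ℓ : ℕ} [Fact ℓ.Prime]

/-- **Qian's characterising property of `r_{l,ι}(π)`** (p. 1, after [HLTT16]): "if `p ≠ l` is a
rational prime above which `π` and `E` are unramified and if `v | p` is a prime of `E`, then
`r_{l,ι}(π)` is unramified at `v` [and] `r_{l,ι}(π)|^{ss}_{W_{E_v}} = ι⁻¹ rec_{E_v}(π_v|det|_v^{(1-n)/2})`":
for every rational prime `p ≠ ℓ` with `K` unramified above `p` (Mathlib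
`Algebra.IsUnramifiedIn (𝓞 K) (p)`) and `π` unramified above `p` (`IsUnramifiedAbove`), and every
place `v ∣ p`, `r` is compatible with `π` at `v` (`IsGaloisCompatibleAt`: unramified, with
arithmetic-Frobenius characteristic polynomial `arithFrobPolyOfSatake ι q_v n α` for the Satake
parameter `α` of `π_v` — the tree's form of the displayed identity for unramified `π_v`).
[cite: Qian2022, §1 (p. 1, definition of r_{l,ι}(π))] -/
def IsCompatible {hcpt : isCompact_glFiniteIntegralLevel n K}
    (π : AutomorphicRepData (AutomorphyDatum.gl n K hcpt)) (ι : PadicAlgCl ℓ ≃+* ℂ)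
    (r : FramedGaloisRep K (PadicAlgCl ℓ) n) : Prop :=
  ∀ p : ℕ, p.Prime → p ≠ ℓ → Algebra.IsUnramifiedIn (𝓞 K) (Ideal.span {(p : ℤ)}) →
    π.IsUnramifiedAbove p →
      ∀ v : HeightOneSpectrum (𝓞 K), ((p : ℕ) : 𝓞 K) ∈ v.asIdeal → IsGaloisCompatibleAt π ι r v

/-- HLTT's published property (`HarrisLanTaylorThorne2016.IsCompatible`: no condition on `K` at
`p`) implies Qian's (which also asks `K` unramified above `p`). [folklore] -/
theorem isCompatible_of_hltt {hcpt : isCompact_glFiniteIntegralLevel n K}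
    {π : AutomorphicRepData (AutomorphyDatum.gl n K hcpt)} {ι : PadicAlgCl ℓ ≃+* ℂ}
    {r : FramedGaloisRep K (PadicAlgCl ℓ) n} (h : HarrisLanTaylorThorne2016.IsCompatible π ι r) :
    IsCompatible π ι r :=
  fun p hp hpℓ _ hπ v hv => h p hp hpℓ hπ v hv

/-- **`r : Γ_K →ₜ* GL_n(ℚ̄_ℓ)` is automorphic** (Qian 2023, Def. 1.3: "there exists a regular
algebraic cuspidal automorphic representation `π` such that `r ≅ r_{l,ι}(π)`"), relative to
`ι : ℚ̄_ℓ ≃ ℂ`: `r` is semisimple and there is a cuspidal automorphic representation `π` of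
`GL_n(𝔸_K)` (accepted `CuspidalAutomorphicRepData`, typed by the compactness fact `hcpt`, part of
the existential) which is regular algebraic (`IsRegularAlgebraic`) and for which `r` has the
characterising property of `r_{l,ι}(π)` (`IsCompatible`).  Since `r_{l,ι}(π)` is by definition
the unique continuous semisimple representation with that property, this is `r ≅ r_{l,ι}(π)`.
[cite: Qian2022, Def. 1.3] -/
def IsAutomorphic (ι : PadicAlgCl ℓ ≃+* ℂ) (r : FramedGaloisRep K (PadicAlgCl ℓ) n) : Prop :=
  r.toGaloisRep.IsSemisimple ∧
    ∃ (hcpt : isCompact_glFiniteIntegralLevel n K) (π : CuspidalAutomorphicRepData n K hcpt),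
      π.1.IsRegularAlgebraic ∧ IsCompatible π.1 ι r

/-- Unfolding lemma for `IsAutomorphic`. [folklore] -/
lemma isAutomorphic_iff (ι : PadicAlgCl ℓ ≃+* ℂ) (r : FramedGaloisRep K (PadicAlgCl ℓ) n) :
    IsAutomorphic ι r ↔
      r.toGaloisRep.IsSemisimple ∧
        ∃ (hcpt : isCompact_glFiniteIntegralLevel n K) (π : CuspidalAutomorphicRepData n K hcpt),
          π.1.IsRegularAlgebraic ∧ IsCompatible π.1 ι r :=
  Iff.rfl

/-- A semisimple `r` with HLTT's published property for a regular algebraic cuspidal `π` (e.g.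
the representation provided by `HarrisLanTaylorThorne2016.theoremA_existence`) is automorphic in
Qian's sense. [folklore] -/
theorem IsAutomorphic.of_hltt {ι : PadicAlgCl ℓ ≃+* ℂ} {r : FramedGaloisRep K (PadicAlgCl ℓ) n}
    (hr : r.toGaloisRep.IsSemisimple) (hcpt : isCompact_glFiniteIntegralLevel n K)
    (π : CuspidalAutomorphicRepData n K hcpt) (hπ : π.1.IsRegularAlgebraic)
    (h : HarrisLanTaylorThorne2016.IsCompatible π.1 ι r) : IsAutomorphic ι r :=
  ⟨hr, hcpt, π, hπ, isCompatible_of_hltt h⟩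

/-- An automorphic representation is semisimple. [folklore] -/
lemma IsAutomorphic.isSemisimple {ι : PadicAlgCl ℓ ≃+* ℂ} {r : FramedGaloisRep K (PadicAlgCl ℓ) n}
    (h : IsAutomorphic ι r) : r.toGaloisRep.IsSemisimple :=
  h.1

end Automorphic

/-! ### Theorem 1.4 -/

/-- **Qian 2023, Theorem 1.4** (potential automorphy of a single ordinary `ℓ`-adic
representation over a CM field), NAMED FACT, relative to local Artin data `𝓐 K v` (intended: the
Artin map of local class field theory for `K_v`, geometric Frobenius ↦ uniformiser) and `p`-adic
Hodge data `𝓓 K p v` at `v ∣ p` (intended: `B_dR(K_v)` and `WD ∘ D_pst`) — parameters, see the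
module docstring.  For every CM number field `K`, every finite extension `K^{av}/K`, every
`n ≥ 2`, prime `ℓ`, `ι : ℚ̄_ℓ ≃ ℂ` and continuous `r : Γ_K → GL_n(ℚ̄_ℓ)` such that
(i) `r` is unramified at all but finitely many places; (ii) for every `v ∣ ℓ`, `r|_{Γ_{K_v}}` is
de Rham relative to `𝓓 K ℓ v` ("potentially semistable") and ordinary with regular Hodge–Tate
weights (Def. 1.2, `IsOrdinaryRegularAt v (𝓐 K v) r`); (iii) some residual representation
`τ : Γ_K → GL_n(ℤ̄_ℓ/𝔪)` of `r` (`IsResidualRepOf`, `𝔽̄_ℓ`-coefficients) is absolutely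
irreducible and decomposed generic (ACC+ Def. 4.3.1, `IsDecomposedGeneric`) with
`τ|_{Γ_{K(ζ_ℓ)}}` absolutely irreducible of enormous image (ACC+ Def. 6.2.28: "an absolutely
irreducible subgroup … is called enormous if" (1)–(3) = `Subgroup.IsEnormous`); (iv) `τ σ` is
scalar for
some `σ ∈ Γ_K ∖ Γ_{K(ζ_ℓ)}` — there is a number field `K′`, Galois over `K` and CM, linearly
disjoint from `K^{av}` over `K` (`K^{av} ⊗_K K′` is a field), such that `r|_{Γ_{K′}}` is
automorphic (Def. 1.3, `IsAutomorphic`: `≅ r_{l,ι}(π)` for a regular algebraic cuspidal `π` of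
`GL_n(𝔸_{K′})`).  The printed conclusion "ordinarily automorphic" additionally restates (ii) for
`r|_{Γ_{K′}}`; only the automorphy clause is vendored (weaker than printed).
[cite: Qian2022, Thm. 1.4 (with Def. 1.2, Def. 1.3)] -/
def potentialAutomorphy_ordinary
    (𝓐 : ∀ (K : Type) [Field K] [NumberField K] (v : HeightOneSpectrum (𝓞 K)),
      LocalArtinData (v.adicCompletion K))
    (𝓓 : ∀ (K : Type) [Field K] [NumberField K] (p : ℕ) [Fact p.Prime]
      (v : HeightOneSpectrum (𝓞 K)), ((p : ℕ) : 𝓞 K) ∈ v.asIdeal →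
        PstWeilDeligneData (v.adicCompletion K) p) : Prop :=
  ∀ (K : Type) [Field K] [NumberField K], IsCMField K →
    ∀ (Kav : Type) [Field Kav] [Algebra K Kav], FiniteDimensional K Kav →
    ∀ (n : ℕ), 2 ≤ n →
    ∀ (ℓ : ℕ) [Fact ℓ.Prime] (ι : PadicAlgCl ℓ ≃+* ℂ) (r : FramedGaloisRep K (PadicAlgCl ℓ) n),
      -- (i) unramified almost everywhere
      (∀ᶠ v : HeightOneSpectrum (𝓞 K) in cofinite, r.IsUnramifiedAt v) →
      -- (ii) potentially semistable and ordinary with regular Hodge–Tate weights at `v ∣ ℓ`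
      (∀ (v : HeightOneSpectrum (𝓞 K)) (hv : ((ℓ : ℕ) : 𝓞 K) ∈ v.asIdeal),
        (𝓓 K ℓ v hv).IsDeRhamFramed (r.toLocal v) ∧ r.IsOrdinaryRegularAt v (𝓐 K v)) →
      -- (iii), (iv) the residual hypotheses
      (∃ τ : absoluteGaloisGroup K →* GL (Fin n) (padicAlgClResidueField ℓ),
        r.IsResidualRepOf (RingHom.id _) τ ∧ IsAbsIrreducible τ ∧ IsDecomposedGeneric τ ∧
          IsAbsIrreducible (τ.comp (absGaloisGroupAdjoinRootsOfUnity K ℓ).subtype) ∧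
          Subgroup.IsEnormous ((absGaloisGroupAdjoinRootsOfUnity K ℓ).map τ) ∧
          ∃ σ : absoluteGaloisGroup K, σ ∉ absGaloisGroupAdjoinRootsOfUnity K ℓ ∧
            ∃ c : padicAlgClResidueField ℓ,
              ((τ σ : GL (Fin n) (padicAlgClResidueField ℓ)) :
                Matrix (Fin n) (Fin n) (padicAlgClResidueField ℓ)) = c • (1 : Matrix _ _ _)) →
      -- conclusion
      ∃ (K' : Type) (_ : Field K') (_ : NumberField K') (_ : Algebra K K'),
        IsGalois K K' ∧ IsCMField K' ∧ IsField (Kav ⊗[K] K') ∧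
          IsAutomorphic ι (r.restrictField K')

/-! ### Theorem 1.1 -/

/-- **Qian 2023, Theorem 1.1** (potential automorphy of a residual representation over a CM
field), NAMED FACT.  As printed (p. 1): "Suppose `F` is a CM number field, `F^{av}` is a finite
extension of `F` and `n ≥ 2` is a positive integer. Let `l` be a prime number and suppose that
`r̄ : Gal(F̄/F) → GL_n(F̄_l)` is a continuous semisimple representation. Then there exists a finite
CM Galois extension `F′/F` linearly disjoint from `F^{av}` over `F` such that `r̄|_{Gal(F̄/F′)}` is
ordinarily automorphic."  (Def. 1.3: a residual representation is *automorphic* if it has an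
automorphic lift, *ordinarily automorphic* if it has an automorphic lift which is potentially
semistable and ordinary with regular Hodge–Tate weights at all `v ∣ l`.)
Rendering.  The residual representation is given, as everywhere in this tree, as a residual
representation `τ : Γ_K → GL_n(ℤ̄_ℓ/𝔪)` (`IsResidualRepOf`, `𝔽̄_ℓ`-coefficients) of SOME
continuous `r : Γ_K →ₜ* GL_n(ℚ̄_ℓ)`; such a `τ` is continuous and semisimple, so the vendored
hypothesis is a special case of the printed one.  Restriction to `Γ_{K′}` is expressed through
`r`: the conclusion provides a residual representation `τ′` of `r|_{Γ_{K′}}` (`restrictField`;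
`r̄|_{Γ_{K′}}` is one, and any two are conjugate by Brauer–Nesbitt) and an automorphic (Def. 1.3,
`IsAutomorphic ι`: `≅ r_{l,ι}(π)` for a regular algebraic cuspidal `π` of `GL_n(𝔸_{K′})`)
`r′ : Γ_{K′} →ₜ* GL_n(ℚ̄_ℓ)` having `τ′` as a residual representation — an automorphic lift of
`r̄|_{Γ_{K′}}`.  Of "ordinarily automorphic" only the automorphy clause is vendored (WEAKER than
printed).  `ι : ℚ̄_l ≅ ℂ` is fixed once in the source (p. 1), so the statement is uniform in `ι`.
Nearest print to — NOT a match for — `Summit.Langlands.Langlands.Theses.TameTypeSwitch.TameTypedWitness`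
(stmt-Langlands-18269), which moreover demands `ℓ` unramified in `K′` and a weight-`0` witness of
depth zero above `ℓ` with explicit Satake–Frobenius data; Qian's proof (§4, Prop. 4.2 with
`l ∈ S₃`, pp. 23–24) gives no control of `K′` above `l`.
[cite: Qian2022, Thm. 1.1 (p. 1), Def. 1.3 (p. 2)] -/
def potentialResidualAutomorphy : Prop :=
  ∀ (K : Type) [Field K] [NumberField K], IsCMField K →
    ∀ (Kav : Type) [Field Kav] [Algebra K Kav], FiniteDimensional K Kav →
    ∀ (n : ℕ), 2 ≤ n →
    ∀ (ℓ : ℕ) [Fact ℓ.Prime] (ι : PadicAlgCl ℓ ≃+* ℂ) (r : FramedGaloisRep K (PadicAlgCl ℓ) n)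
      (τ : absoluteGaloisGroup K →* GL (Fin n) (padicAlgClResidueField ℓ)),
      r.IsResidualRepOf (RingHom.id _) τ →
      ∃ (K' : Type) (_ : Field K') (_ : NumberField K') (_ : Algebra K K'),
        IsGalois K K' ∧ IsCMField K' ∧ IsField (Kav ⊗[K] K') ∧
          ∃ (τ' : absoluteGaloisGroup K' →* GL (Fin n) (padicAlgClResidueField ℓ))
            (r' : FramedGaloisRep K' (PadicAlgCl ℓ) n),
            (r.restrictField K').IsResidualRepOf (RingHom.id _) τ' ∧
              r'.IsResidualRepOf (RingHom.id _) τ' ∧ IsAutomorphic ι r'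

end Qian2022

end Literature.NumberTheory.Automorphic
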